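import Summits.PneNP.Statement
import Summits.PneNP.PneNP.Theorems.SymmetryBudgetRigidBenchmarkNPEquivalence
import Literature.Computability.Complexity.ThreeColouringMachine
import Literature.Computability.Complexity.ClayProblemConsequences
import Literature.Computability.Complexity.CircuitClassesUniformProofs
import Literature.Computability.Complexity.CookBridges

/-!
# Calibration of `SymmetryBudget.RigidBenchmark` (item stmt-PneNP-2149), VII:
# the item IS the summit's circuit-lower-bound conjecture, and implies the summit

`SymmetryBudgetRigidBenchmarkNPEquivalence.lean` proves
`rigidBenchmark_iff_npNotSubsetPPoly_of : IsNPComplete THREECOL → (RigidBenchmark ↔ NPNotSubsetPPoly)`.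
The NP-completeness of GRAPH 3-COLOURABILITY is a theorem of the tree
(`THREECOL_isNPComplete`, `ThreeColouringMachine.lean`), so the hypothesis is discharged here:

* `rigidBenchmark_iff_npNotSubsetPPoly : RigidBenchmark ↔ NPNotSubsetPPoly` — UNCONDITIONAL: the
  route's rigid-instance benchmark (full `Sym(Fin m)`-symmetry, promise to colour-refinement-discrete
  inputs, 3-colourability) is, up to a kernel-checked equivalence, the registered open conjecture
  `NP ⊄ P/poly` (`@[conjecture] def Summit.PneNP.PneNP.NPNotSubsetPPoly`, CookClay2006 §3);
* `rigidBenchmark_imp_P_ne_NP`, `rigidBenchmark_imp_pneNP` — consequently the item implies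
  `Classes.P ≠ Nondeterministic.NP` (`P ⊆ P/poly`, `P_subset_PPoly_holds`, Arora–Barak Thm. 6.6) and
  the summit statement `PneNP` itself (Cook's shape, `pneNP_shape_of_P_ne_NP`);
* `NP_subset_PPoly_of_not_rigidBenchmark` — and a refutation of the item would put `NP ⊆ P/poly`.

Status consequence for the ledger: stmt-PneNP-2149 can be closed `proved` only together with the
summit and `refuted` only together with `NP ⊆ P/poly`; it is parked on the conjecture leaf
`NPNotSubsetPPoly`, of which it is a restatement.
-/

-- `Summit.PneNP.PneNP.…` duplicates `PneNP` BY DESIGN (single-problem summit, D-0017); the Summits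
-- library sets this option globally (lakefile), repeated here so a standalone `lean check` is warning-free.
set_option linter.dupNamespace false

namespace Summit.PneNP.PneNP.Theorems

open Literature.Computability.Complexity _root_.Computability
open Summit.PneNP.PneNP.Theses.SymmetryBudget (RigidBenchmark)

/-- **`RigidBenchmark ↔ NPNotSubsetPPoly`, unconditionally.** The route's rigid-instance benchmark
is equivalent to the conjecture `NP ⊄ P/poly`: `rigidBenchmark_iff_npNotSubsetPPoly_of` with its
hypothesis `IsNPComplete THREECOL` discharged by `THREECOL_isNPComplete` (Garey–Johnson [GT4]). -/
theorem rigidBenchmark_iff_npNotSubsetPPoly : RigidBenchmark ↔ NPNotSubsetPPoly :=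
  rigidBenchmark_iff_npNotSubsetPPoly_of THREECOL_isNPComplete

/-- **Refuting the benchmark means `NP ⊆ P/poly`.** -/
theorem NP_subset_PPoly_of_not_rigidBenchmark (h : ¬ RigidBenchmark) :
    Nondeterministic.NP ⊆ PPoly :=
  Classical.not_not.mp fun hn => h (rigidBenchmark_iff_npNotSubsetPPoly.mpr hn)

/-- **The benchmark implies `P ≠ NP`** (prelude classes over `{0,1}`): `NP ⊄ P/poly` and
`P ⊆ P/poly` (`P_subset_PPoly_holds`, Arora–Barak 2009 Thm. 6.6). -/
theorem rigidBenchmark_imp_P_ne_NP (h : RigidBenchmark) : Classes.P ≠ Nondeterministic.NP :=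
  NPNotSubsetPPoly.P_ne_NP (rigidBenchmark_iff_npNotSubsetPPoly.mp h) P_subset_PPoly_holds

/-- **The benchmark implies the summit statement `PneNP`** (Cook's shape `∃ L ∈ NP, L ∉ P` over
`PNPWave0`, from `Classes.P ≠ Nondeterministic.NP` by the proved model bridges,
`pneNP_shape_of_P_ne_NP`). So the support item stmt-PneNP-2149 is at least as strong as the whole
sub-problem it was filed under. -/
theorem rigidBenchmark_imp_pneNP (h : RigidBenchmark) : _root_.PneNP :=
  pneNP_shape_of_P_ne_NP (rigidBenchmark_imp_P_ne_NP h)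

end Summit.PneNP.PneNP.Theorems
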